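/-
Copyright (c) 2026 the pub-hodgecm-mathlib formalisation cell (harness21).  Prover seat hodgecm-mathlib-A-p19 (g24) — (U) road, U4-DISCHARGE junction (n5′), 2026-09-01.
-/
import Summits.HodgeConjecture.HodgeConjecture.Theorems.F0P3ArchTopFormWallCompatibleOfBlocks   -- ★ p844761 ED. 2: `archTopFormWallCompatible_of_massEqSource_of_clause`
import Literature.NumberTheory.Rogawski1990.ArchLimitFormulaNoncompactWallClauseExplicit     -- ★ p844887: the (J-nc) clause for the wall-block product measure, constant `μ₁(univ)·C`
import Literature.NumberTheory.Rogawski1990.ArchCentralDescentAssemblyKit                  -- ★ `isMulRightInvariant_of_isHaarMeasure_archLocal_diagonal`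
import HarnessLib

/-!
# U4 `ArchTopFormWallCompatible L` from (ii) and ONE rank-one statement: «the (R1G) constant of the top-form Haar measure of the indefinite rank-2 block is `−V₂`»
# ((U) road, U4-DISCHARGE junction (n5′); MEMO-U4-NC-v1; Rogawski 1990 §8.2 p. 118∕119, Varadarajan 1989 §6.4 Thm 22)

Cell `pub/hodgecm-mathlib`, F0∕P3a, crux H413 (`stmt-HodgeConjecture-24833`, `--supports … --as helper`); namespace
`Summit.HodgeConjecture.HodgeConjecture.Cruxes.H413.F0P3ArchTopFormWallCompatibleOfRankOneConstant`.  ONE THEOREM (kernel lane); no def, no `sorry`.  HONEST LABEL: HC_CM is proved only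
modulo the 2 remaining named inputs (hLiu418, h413) until rung 0 closes; U4 (`stub_WallCompat` of closer ED. 29, in-house) is NOT proved here — after this file it hangs on exactly
two place-local analytic statements about ★ U1 `archLocalTopFormHaar`:
* (ii) `hii₂`, `hii₁` — «total mass = window-free source integral» at real diagonal carriers of sizes 2, 1 (A-p06 (g29));
* (W2′) `hR1G` — for every complex place `w` and real non-degenerate `β` with `re σβ₀ · re σβ₂ < 0`, Harish-Chandra's rank-one limit formula (★ (R1G) shape, `E = ℂ`) holds for the
  top-form Haar measure `archLocalTopFormHaar L 2 (diagonal(β₀,β₂)) w` of the INDEFINITE `U(σ_w diag(β₀,β₂))(ℂ)` with the constant **`−V₂`**, `V₂ := (∫⁻_{source(1_2)} w₀ dλ).toNNReal` = the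
  top-form mass of the DEFINITE `U(2)` (MEMO-U4-NC-v1 §0: `C = −π·C_disc(μ₂^TF)`, `C_disc^TF = π²∕2`, `V₂ = π³∕2` — Rogawski's «constants differ by a sign», the rank-one case).
COMPOSITION: ★ p844887 `archLimitFormulaNoncompactWall_clause_wallBlockMap` (constant `μ₁(univ)·C`) with `μ₁(univ) = V₁` (★ p844742 `blockMass_one_of_massEqSource`) and `C = −V₂` gives U4's
(nc) conjunct with `−(V₂·V₁)`; ★ p844761 does the rest.
* **`archTopFormWallCompatible_of_massEqSource_of_rankOneConstant (hii₂) (hii₁) (hR1G) : ArchTopFormWallCompatible L`**.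
-/

set_option autoImplicit false
set_option linter.dupNamespace false

noncomputable section

open MeasureTheory Measure Set Filter Topology NumberField NumberField.InfinitePlace NumberField.mixedEmbedding Matrix Equiv
open Literature.MeasureTheory.Group Literature.NumberTheory.Automorphic Literature.NumberTheory.Automorphic.UnitaryGroup
open Literature.NumberTheory.Weil1964 Literature.NumberTheory.Weil1964.UnitaryArchTopForm Literature.NumberTheory.Weil1964.UnitaryArchLocalTopForm
open Literature.NumberTheory.Rogawski1990
open Summit.HodgeConjecture.HodgeConjecture.Cruxes.H413.F0P3ArchTopFormWallCompatible
open Summit.HodgeConjecture.HodgeConjecture.Cruxes.H413.F0P3ArchTopFormWallCompatibleOfBlocks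
open scoped ENNReal NNReal Classical Matrix MatrixGroups Matrix.Norms.Operator ContDiff ComplexConjugate

namespace Summit.HodgeConjecture.HodgeConjecture.Cruxes.H413.F0P3ArchTopFormWallCompatibleOfRankOneConstant

set_option maxHeartbeats 1600000 in
/-- **U4 FROM (ii) AND THE RANK-ONE TOP-FORM CONSTANT `−V₂`.**  See the module docstring. (in-house plumbing; motivated by Rogawski 1990 §8.2 p. 118, §1.7 p. 6; Varadarajan 1989 §6.4 Thm 22) -/
theorem archTopFormWallCompatible_of_massEqSource_of_rankOneConstant (L : Type) [Field L] [NumberField L] [IsCMField L]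
    [MeasurableSpace (skewC 2 (Matrix.diagonal fun _ : Fin 2 => ((1 : ℝ) : ℂ)))] [BorelSpace (skewC 2 (Matrix.diagonal fun _ : Fin 2 => ((1 : ℝ) : ℂ)))] [MeasurableSpace (skewC 1 (Matrix.diagonal fun _ : Fin 1 => ((1 : ℝ) : ℂ)))] [BorelSpace (skewC 1 (Matrix.diagonal fun _ : Fin 1 => ((1 : ℝ) : ℂ)))]
    (hii₂ : (∀ (w : {w : InfinitePlace L // IsComplex w}) (b : Fin 2 → L) (_hb : ∀ i, b i ≠ 0) (_hbr : ∀ i, (IsCMField.complexConj L (b i) : L) = b i)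
      [MeasurableSpace (GL (Fin 2) ℂ)] [BorelSpace (GL (Fin 2) ℂ)]
      [MeasurableSpace (skewC 2 ((Matrix.diagonal b).map w.1.embedding))] [BorelSpace (skewC 2 ((Matrix.diagonal b).map w.1.embedding))],
      archLocalTopFormHaar L 2 (Matrix.diagonal b) w Set.univ =
        ∫⁻ X in cayleySourceC 2 ((Matrix.diagonal b).map w.1.embedding), ENNReal.ofReal (cayleyWeightC 2 ((Matrix.diagonal b).map w.1.embedding) X) ∂(lieStdLebesgueC 2 ((Matrix.diagonal b).map w.1.embedding))))
    (hii₁ : (∀ (w : {w : InfinitePlace L // IsComplex w}) (b : Fin 1 → L) (_hb : ∀ i, b i ≠ 0) (_hbr : ∀ i, (IsCMField.complexConj L (b i) : L) = b i)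
      [MeasurableSpace (GL (Fin 1) ℂ)] [BorelSpace (GL (Fin 1) ℂ)]
      [MeasurableSpace (skewC 1 ((Matrix.diagonal b).map w.1.embedding))] [BorelSpace (skewC 1 ((Matrix.diagonal b).map w.1.embedding))],
      archLocalTopFormHaar L 1 (Matrix.diagonal b) w Set.univ =
        ∫⁻ X in cayleySourceC 1 ((Matrix.diagonal b).map w.1.embedding), ENNReal.ofReal (cayleyWeightC 1 ((Matrix.diagonal b).map w.1.embedding) X) ∂(lieStdLebesgueC 1 ((Matrix.diagonal b).map w.1.embedding))))
    (hR1G : ∀ [MeasurableSpace (GL (Fin 2) ℂ)] [BorelSpace (GL (Fin 2) ℂ)] (w : {w : InfinitePlace L // IsComplex w}) (β : Fin 3 → L) (_hβ : ∀ i, β i ≠ 0)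
      (_hhermβ : ∀ i, (IsCMField.complexConj L (β i) : L) = β i), (w.1.embedding (β 0)).re * (w.1.embedding (β 2)).re < 0 →
      ∀ (f : Matrix (Fin 2) (Fin 2) ℂ → ℂ), ContDiff ℝ 1 f → HasCompactSupport f → ∀ z : Circle,
        Tendsto (fun ψ : ℝ => deriv (fun ψ : ℝ => (2 * Real.sin ψ) •
            ∫ h : ↥(unitaryGroupOfForm (starRingEnd ℂ) ((Matrix.diagonal ![β 0, β 2]).map w.1.embedding)), f (((h * ⟨circleDiagonal 2 ![z * Circle.exp ψ, z * Circle.exp (-ψ)], circleDiagonal_mem_archLocal_diagonal L 2 ![β 0, β 2] w _⟩ * h⁻¹ : ↥(unitaryGroupOfForm (starRingEnd ℂ) ((Matrix.diagonal ![β 0, β 2]).map w.1.embedding))) :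
              GL (Fin 2) ℂ) : Matrix (Fin 2) (Fin 2) ℂ) ∂(archLocalTopFormHaar L 2 (Matrix.diagonal ![β 0, β 2]) w)) ψ)
          (𝓝[≠] 0) (𝓝 ((-(((∫⁻ X in cayleySourceC 2 (Matrix.diagonal fun _ : Fin 2 => ((1 : ℝ) : ℂ)), ENNReal.ofReal (cayleyWeightC 2 (Matrix.diagonal fun _ : Fin 2 => ((1 : ℝ) : ℂ)) X) ∂(lieStdLebesgueC 2 (Matrix.diagonal fun _ : Fin 2 => ((1 : ℝ) : ℂ)))).toNNReal : ℝ≥0) : ℝ)) • f ((z : ℂ) • (1 : Matrix (Fin 2) (Fin 2) ℂ)))) ∧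
        ∀ ψ ∈ Ioo (-1 : ℝ) 1, ψ ≠ 0 → DifferentiableAt ℝ (fun ψ : ℝ => (2 * Real.sin ψ) •
            ∫ h : ↥(unitaryGroupOfForm (starRingEnd ℂ) ((Matrix.diagonal ![β 0, β 2]).map w.1.embedding)), f (((h * ⟨circleDiagonal 2 ![z * Circle.exp ψ, z * Circle.exp (-ψ)], circleDiagonal_mem_archLocal_diagonal L 2 ![β 0, β 2] w _⟩ * h⁻¹ : ↥(unitaryGroupOfForm (starRingEnd ℂ) ((Matrix.diagonal ![β 0, β 2]).map w.1.embedding))) :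
              GL (Fin 2) ℂ) : Matrix (Fin 2) (Fin 2) ℂ) ∂(archLocalTopFormHaar L 2 (Matrix.diagonal ![β 0, β 2]) w)) ψ) :
    ArchTopFormWallCompatible L := by
  refine archTopFormWallCompatible_of_massEqSource_of_clause L hii₂ hii₁ ?_
  intro i2 i2b i1 i1b i3 i3b w β hβ hhermβ z₁ h02 h01 iq iqb hlt
  have hreal : ∀ i, (w.1.embedding (β i)).im = 0 := fun i => UnitaryGroup.im_embedding_eq_zero_of_complexConj_eq L w (hhermβ i)
  haveI := locallyCompactSpace_archLocal L 3 (Matrix.diagonal β) w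
  haveI := secondCountableTopology_archLocal L 3 (Matrix.diagonal β) w
  haveI := locallyCompactSpace_archLocal L 2 (Matrix.diagonal ![β 0, β 2]) w
  haveI := secondCountableTopology_archLocal L 2 (Matrix.diagonal ![β 0, β 2]) w
  haveI := locallyCompactSpace_archLocal L 1 (Matrix.diagonal ![β 1]) w
  haveI := secondCountableTopology_archLocal L 1 (Matrix.diagonal ![β 1]) w
  haveI : LocallyCompactSpace ↥(unitaryGroupOfForm (starRingEnd ℂ) ((Matrix.diagonal ![β 0, β 2]).map w.1.embedding)) := locallyCompactSpace_archLocal L 2 (Matrix.diagonal ![β 0, β 2]) w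
  haveI : SecondCountableTopology ↥(unitaryGroupOfForm (starRingEnd ℂ) ((Matrix.diagonal ![β 0, β 2]).map w.1.embedding)) := secondCountableTopology_archLocal L 2 (Matrix.diagonal ![β 0, β 2]) w
  haveI : LocallyCompactSpace ↥(unitaryGroupOfForm (starRingEnd ℂ) ((Matrix.diagonal ![β 1]).map w.1.embedding)) := locallyCompactSpace_archLocal L 1 (Matrix.diagonal ![β 1]) w
  haveI : SecondCountableTopology ↥(unitaryGroupOfForm (starRingEnd ℂ) ((Matrix.diagonal ![β 1]).map w.1.embedding)) := secondCountableTopology_archLocal L 1 (Matrix.diagonal ![β 1]) w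
  have hb2 : ∀ i, ![β 0, β 2] i ≠ 0 := fun i => by fin_cases i <;> simp [hβ]
  have hbr2 : ∀ i, (IsCMField.complexConj L (![β 0, β 2] i) : L) = ![β 0, β 2] i := fun i => by fin_cases i <;> simp [hhermβ]
  have hb1 : ∀ i, ![β 1] i ≠ 0 := fun i => by fin_cases i; simp [hβ]
  have hbr1 : ∀ i, (IsCMField.complexConj L (![β 1] i) : L) = ![β 1] i := fun i => by fin_cases i; simp [hhermβ]
  haveI i2h : ((archLocalTopFormHaar L 2 (Matrix.diagonal ![β 0, β 2]) w)).IsHaarMeasure := isHaarMeasure_archLocalTopFormHaar_diagonal L 2 w ![β 0, β 2] hb2 hbr2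
  haveI i1h : ((archLocalTopFormHaar L 1 (Matrix.diagonal ![β 1]) w)).IsHaarMeasure := isHaarMeasure_archLocalTopFormHaar_diagonal L 1 w ![β 1] hb1 hbr1
  -- the group Haar measure and its right invariance
  haveI iνr : (Measure.haar : Measure (archLocal L 3 (Matrix.diagonal β) w)).IsMulRightInvariant := isMulRightInvariant_of_isHaarMeasure_archLocal_diagonal L β hβ hhermβ w _
  refine ⟨Measure.haar, inferInstance, iνr, ?_⟩
  -- the mass of the rank-1 block: `μ₁(univ) = V₁` (★ p844742)
  have hm₁ : ((archLocalTopFormHaar L 1 (Matrix.diagonal ![β 1]) w) Set.univ).toReal = (((∫⁻ X in cayleySourceC 1 (Matrix.diagonal fun _ : Fin 1 => ((1 : ℝ) : ℂ)), ENNReal.ofReal (cayleyWeightC 1 (Matrix.diagonal fun _ : Fin 1 => ((1 : ℝ) : ℂ)) X) ∂(lieStdLebesgueC 1 (Matrix.diagonal fun _ : Fin 1 => ((1 : ℝ) : ℂ)))).toNNReal : ℝ≥0) : ℝ) := by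
    rw [(blockMass_one_of_massEqSource L hii₁).2 w (β 1) (hβ 1) (hhermβ 1), ENNReal.coe_toReal]
  -- the block measures in the `unitaryGroupOfForm` spelling of ★ p844887
  set μ₂' : Measure ↥(unitaryGroupOfForm (starRingEnd ℂ) ((Matrix.diagonal ![β 0, β 2]).map w.1.embedding)) := (archLocalTopFormHaar L 2 (Matrix.diagonal ![β 0, β 2]) w) with hμ₂'
  set μ₁' : Measure ↥(unitaryGroupOfForm (starRingEnd ℂ) ((Matrix.diagonal ![β 1]).map w.1.embedding)) := (archLocalTopFormHaar L 1 (Matrix.diagonal ![β 1]) w) with hμ₁'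
  haveI i2u : μ₂'.IsHaarMeasure := i2h
  haveI i1u : μ₁'.IsHaarMeasure := i1h
  haveI iθ : (Measure.map (fun p : ↥(archLocal L 2 (Matrix.diagonal ![β 0, β 2]) w) × ↥(archLocal L 1 (Matrix.diagonal ![β 1]) w) =>
            (⟨endoEmb (starRingEnd ℂ) ((Matrix.diagonal ![β 0, β 2]).map w.1.embedding) ((Matrix.diagonal ![β 1]).map w.1.embedding)
                ((Matrix.diagonal β).map w.1.embedding) (endoForm_archLocal_diagonal L β w) p,
              endoEmb_mem_centralizer_circleDiagonal L β w h02 p⟩ : ↥(Subgroup.centralizer ({(⟨circleDiagonal 3 z₁, circleDiagonal_mem_archLocal_diagonal L 3 β w z₁⟩ : archLocal L 3 (Matrix.diagonal β) w)} : Set (archLocal L 3 (Matrix.diagonal β) w)))))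
          ((μ₂').prod (μ₁'))).IsHaarMeasure := isHaarMeasure_wallBlockMap L β w h02 h01 _ _
  haveI iθi : (Measure.map (fun p : ↥(archLocal L 2 (Matrix.diagonal ![β 0, β 2]) w) × ↥(archLocal L 1 (Matrix.diagonal ![β 1]) w) =>
            (⟨endoEmb (starRingEnd ℂ) ((Matrix.diagonal ![β 0, β 2]).map w.1.embedding) ((Matrix.diagonal ![β 1]).map w.1.embedding)
                ((Matrix.diagonal β).map w.1.embedding) (endoForm_archLocal_diagonal L β w) p,
              endoEmb_mem_centralizer_circleDiagonal L β w h02 p⟩ : ↥(Subgroup.centralizer ({(⟨circleDiagonal 3 z₁, circleDiagonal_mem_archLocal_diagonal L 3 β w z₁⟩ : archLocal L 3 (Matrix.diagonal β) w)} : Set (archLocal L 3 (Matrix.diagonal β) w)))))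
          ((μ₂').prod (μ₁'))).IsInvInvariant :=
    isInvInvariant_of_isHaarMeasure_centralizer_wall L β w hβ hreal h02 h01 _
  have hm₁' : (μ₁' Set.univ).toReal = (((∫⁻ X in cayleySourceC 1 (Matrix.diagonal fun _ : Fin 1 => ((1 : ℝ) : ℂ)), ENNReal.ofReal (cayleyWeightC 1 (Matrix.diagonal fun _ : Fin 1 => ((1 : ℝ) : ℂ)) X) ∂(lieStdLebesgueC 1 (Matrix.diagonal fun _ : Fin 1 => ((1 : ℝ) : ℂ)))).toNNReal : ℝ≥0) : ℝ) := hm₁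
  -- the (J-nc) clause for the wall-block product measure with constant `μ₁(univ) · (−V₂)` (★ p844887), then `μ₁(univ) = V₁`
  have hcl := archLimitFormulaNoncompactWall_clause_wallBlockMap L β w hβ hreal (Measure.haar : Measure (archLocal L 3 (Matrix.diagonal β) w)) z₁ h02 h01 μ₂' μ₁'
    (Measure.map (fun p : ↥(archLocal L 2 (Matrix.diagonal ![β 0, β 2]) w) × ↥(archLocal L 1 (Matrix.diagonal ![β 1]) w) =>
            (⟨endoEmb (starRingEnd ℂ) ((Matrix.diagonal ![β 0, β 2]).map w.1.embedding) ((Matrix.diagonal ![β 1]).map w.1.embedding)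
                ((Matrix.diagonal β).map w.1.embedding) (endoForm_archLocal_diagonal L β w) p,
              endoEmb_mem_centralizer_circleDiagonal L β w h02 p⟩ : ↥(Subgroup.centralizer ({(⟨circleDiagonal 3 z₁, circleDiagonal_mem_archLocal_diagonal L 3 β w z₁⟩ : archLocal L 3 (Matrix.diagonal β) w)} : Set (archLocal L 3 (Matrix.diagonal β) w)))))
          ((μ₂').prod (μ₁'))) rfl
    (-(((∫⁻ X in cayleySourceC 2 (Matrix.diagonal fun _ : Fin 2 => ((1 : ℝ) : ℂ)), ENNReal.ofReal (cayleyWeightC 2 (Matrix.diagonal fun _ : Fin 2 => ((1 : ℝ) : ℂ)) X) ∂(lieStdLebesgueC 2 (Matrix.diagonal fun _ : Fin 2 => ((1 : ℝ) : ℂ)))).toNNReal : ℝ≥0) : ℝ)) (hR1G w β hβ hhermβ hlt)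
  have hc : ((((μ₁' Set.univ).toReal * (-(((∫⁻ X in cayleySourceC 2 (Matrix.diagonal fun _ : Fin 2 => ((1 : ℝ) : ℂ)), ENNReal.ofReal (cayleyWeightC 2 (Matrix.diagonal fun _ : Fin 2 => ((1 : ℝ) : ℂ)) X) ∂(lieStdLebesgueC 2 (Matrix.diagonal fun _ : Fin 2 => ((1 : ℝ) : ℂ)))).toNNReal : ℝ≥0) : ℝ)) : ℝ)) : ℂ) =
      (-(((∫⁻ X in cayleySourceC 2 (Matrix.diagonal fun _ : Fin 2 => ((1 : ℝ) : ℂ)), ENNReal.ofReal (cayleyWeightC 2 (Matrix.diagonal fun _ : Fin 2 => ((1 : ℝ) : ℂ)) X) ∂(lieStdLebesgueC 2 (Matrix.diagonal fun _ : Fin 2 => ((1 : ℝ) : ℂ)))).toNNReal *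
            (∫⁻ X in cayleySourceC 1 (Matrix.diagonal fun _ : Fin 1 => ((1 : ℝ) : ℂ)), ENNReal.ofReal (cayleyWeightC 1 (Matrix.diagonal fun _ : Fin 1 => ((1 : ℝ) : ℂ)) X) ∂(lieStdLebesgueC 1 (Matrix.diagonal fun _ : Fin 1 => ((1 : ℝ) : ℂ)))).toNNReal : ℝ≥0) : ℂ)) := by
    rw [hm₁']; push_cast; ring
  rw [hc] at hcl
  exact hcl

end Summit.HodgeConjecture.HodgeConjecture.Cruxes.H413.F0P3ArchTopFormWallCompatibleOfRankOneConstant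

end
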